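import Summits.SmoothPoincare4.SmoothPoincare4.Theorems.ConvexBisectionAcyclicBisectionExistsDualLinkFraming
import Summits.SmoothPoincare4.SmoothPoincare4.Theorems.ConvexBisectionAcyclicBisectionExistsSeamTwistSignAmbient
import Summits.SmoothPoincare4.SmoothPoincare4.Theorems.ConvexBisectionAcyclicBisectionExistsDualHandlePlumbing
import HarnessLib

/-!
# Hgap ▸ part B (page twisting of the straightened dual framed knot), brick G2-0 (plumbing):
# the transported dual framed knot in the belt-tube chart
(wave 6, crux stmt-SmoothPoincare4-10508, line `modp-braid-orbits`, stub `stub_T3_dualPresentation` (T3)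
▸ node `Hgap` ▸ part B `helper_Hgap_twisting`; registered sub-goal `helper_dualFraming_chart`)

The framed knot of Hgap's twisting clause is the TRANSPORT by the time-1 map `R₁` of the fibred
straightening of the dual attaching circle/framing of `q = dualMap D bX (bBase g) Ψ col κ δ … j`.  This
file identifies it with the belt-tube chart `Γ_θ (m) = R₁ (seam (β♭ (θ, m)))` of
`…HgapTwistRadial.lean` (`β♭ = (beltMap D j).boundaryTube`, `seam = incl ∘ seamDiffeo bX (bBase g) Ψ`):

* §1 `q.attachingCircle θ = seam (β♭ (θ, 0))` (`dualCircle_eq_chart`), so the transported circle is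
  `θ ↦ Γ_θ (0)` (`transport_dualCircle_eq_chart`);
* §2 **the transported dual framing, read in `ℝ⁴`, is `κ •` the fibre derivative of the chart**
  (`ambient_transport_dualFraming`, registered `helper_dualFraming_chart`):
  `ambient (dR₁ (q.attachingFraming θ)) = κ • ∂_m|₀ (Γ_θ (m)).1 (e₀)` — the dual framing is
  `κ • d(seam)(∂_v|₀ β♭ (θ, v) e₀)` (Z7 `attachingFraming_pushedMap`,
  `tail_attachingFraming_eq_mfderiv_boundaryTube`) and the chain rule through `R₁` and the inclusion
  `Base g ↪ ℝ⁴`.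

Hence the twisting loop of Hgap's framed knot is `(⟪κ Λ_θ e₀, i T⟫, ⟪κ Λ_θ e₀, n⟫)` with
`Λ_θ = ∂_m Γ_θ (0)` the linear map whose normal component is computed by `fderiv_beltSlope_radial`
(`…HgapTwistRadial.lean`) and `hasFDerivAt_pageSlope_comp` (`…HgapTwistModel.lean`).

Everything is proved; no named facts, no `sorry`.  References: J. Milnor, *Lectures on the h-cobordism
theorem* (1965), §3 [MilnorHCobordism1965]; A. A. Kosinski, *Differential Manifolds* (1993), VI §6
[Kosinski1993].
-/

noncomputable section

set_option linter.dupNamespace false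

open scoped Manifold ContDiff Topology
open Set Function Metric
open Literature.Topology.FourManifolds Literature.Topology.FourManifolds.HandleAttachingMap
  Literature.Topology.FourManifolds.LefschetzBase

namespace Summit.SmoothPoincare4.SmoothPoincare4.Theorems.AcyclicBisectionExists.ModpBraidOrbits

variable {g : ℕ} {ι : Type} [Finite ι] {h : ι → HandleAttachingMap 3 2 (Base g)}
  {X : Type} [TopologicalSpace X] [ChartedSpace (EuclideanHalfSpace 4) X] [IsManifold (𝓡∂ 4) ∞ X]
  (D : MultiAttachmentData h (𝓡∂ 4) X) (bX : BoundaryData (𝓡∂ 4) X (𝓡 3))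
  (Ψ : bX.carrier ≃ₘ⟮𝓡 3, 𝓡 3⟯ (bBase g).carrier)
  (col : (BoundaryManifold.boundaryData 3 (Base g)).Collar) (κ δ : ℝ) (hκ : 0 < κ) (hκ1 : κ ≤ 1)
  (hδ : 0 < δ) (hδ2 : δ ≤ 1 / 2)

/-! ## §1 The dual attaching circle in the belt-tube chart -/

/-- **The dual attaching circle is the seam push of the core of the belt tube**:
`q.attachingCircle θ = incl (seamDiffeo (β♭ (θ, 0)))`. [cite: MilnorHCobordism1965, §3] -/
theorem dualCircle_eq_chart (j : ι) (θ : sphere (0 : EuclideanSpace ℝ (Fin 2)) 1) :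
    (dualMap D bX (bBase g) Ψ col κ δ hκ hκ1 hδ hδ2 j).attachingCircle θ =
      (BoundaryManifold.boundaryData 3 (Base g)).incl (seamDiffeo bX (bBase g) Ψ
        ((beltMap D j).boundaryTube.toHomeo (θ, (0 : EuclideanSpace ℝ (Fin 2))))) := by
  rw [dualMap, attachingCircle_pushedMap]
  congr 2
  apply Subtype.ext
  exact ((beltMap D j).coe_boundaryTube_core θ).symm

/-- The transported dual attaching circle in the chart: `R₁ (q.attachingCircle θ) = Γ_θ (0)`.
[folklore] -/
theorem transport_dualCircle_eq_chart (R₁ : Base g → Base g) (j : ι)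
    (θ : sphere (0 : EuclideanSpace ℝ (Fin 2)) 1) :
    R₁ ((dualMap D bX (bBase g) Ψ col κ δ hκ hκ1 hδ hδ2 j).attachingCircle θ) =
      R₁ ((BoundaryManifold.boundaryData 3 (Base g)).incl (seamDiffeo bX (bBase g) Ψ
        ((beltMap D j).boundaryTube.toHomeo (θ, (0 : EuclideanSpace ℝ (Fin 2)))))) := by
  rw [dualCircle_eq_chart]

/-! ## §2 The transported dual framing in the belt-tube chart -/

/-- **The fibre map of the pushed belt tube has the composite differential**: for `R₁` differentiable
at the dual circle point, `m ↦ (R₁ (seam (β♭ (θ, m)))).1` has (manifold) derivative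
`ambient ∘ dR₁ ∘ d(seam) ∘ ∂_v β♭(θ, ·)` at `0`. [folklore] -/
theorem hasMFDerivAt_beltChart {R₁ : Base g → Base g} (j : ι) (θ : sphere (0 : EuclideanSpace ℝ (Fin 2)) 1)
    (hR₁ : MDifferentiableAt (𝓡∂ 4) (𝓡∂ 4) R₁
      ((BoundaryManifold.boundaryData 3 (Base g)).incl (seamDiffeo bX (bBase g) Ψ
        ((beltMap D j).boundaryTube.toHomeo (θ, (0 : EuclideanSpace ℝ (Fin 2))))))) :
    HasMFDerivAt 𝓘(ℝ, EuclideanSpace ℝ (Fin 2)) 𝓘(ℝ, EuclideanSpace ℝ (Fin 4))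
      (fun m : EuclideanSpace ℝ (Fin 2) =>
        (R₁ ((BoundaryManifold.boundaryData 3 (Base g)).incl (seamDiffeo bX (bBase g) Ψ
          ((beltMap D j).boundaryTube.toHomeo (θ, m))))).1) 0
      ((ambientCLM g (R₁ ((BoundaryManifold.boundaryData 3 (Base g)).incl (seamDiffeo bX (bBase g) Ψ
          ((beltMap D j).boundaryTube.toHomeo (θ, (0 : EuclideanSpace ℝ (Fin 2)))))))).comp
        ((mfderiv (𝓡∂ 4) (𝓡∂ 4) R₁ ((BoundaryManifold.boundaryData 3 (Base g)).incl
            (seamDiffeo bX (bBase g) Ψ ((beltMap D j).boundaryTube.toHomeo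
              (θ, (0 : EuclideanSpace ℝ (Fin 2))))))).comp
          ((mfderiv (𝓡 3) (𝓡∂ 4) (fun y => (BoundaryManifold.boundaryData 3 (Base g)).incl
              (seamDiffeo bX (bBase g) Ψ y)) ((beltMap D j).boundaryTube.toHomeo
                (θ, (0 : EuclideanSpace ℝ (Fin 2))))).comp
            (mfderiv 𝓘(ℝ, EuclideanSpace ℝ (Fin 2)) (𝓡 3)
              (fun v : EuclideanSpace ℝ (Fin 2) => (beltMap D j).boundaryTube.toHomeo (θ, v)) 0)))) := by
  -- the fibre map of the belt tube
  set c : EuclideanSpace ℝ (Fin 2) → (BoundaryManifold.boundaryData 3 X).carrier :=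
    fun v => (beltMap D j).boundaryTube.toHomeo (θ, v) with hc
  have hcs : ContMDiffAt 𝓘(ℝ, EuclideanSpace ℝ (Fin 2)) (𝓡 3) ∞ c 0 :=
    ((beltMap D j).boundaryTube.contMDiffAt_toHomeo ((beltMap D j).boundaryTube.mem_source_zero θ)).comp 0
      (contMDiffAt_const.prodMk contMDiffAt_id)
  have hcd : HasMFDerivAt 𝓘(ℝ, EuclideanSpace ℝ (Fin 2)) (𝓡 3) c 0
      (mfderiv 𝓘(ℝ, EuclideanSpace ℝ (Fin 2)) (𝓡 3) c 0) :=
    (hcs.mdifferentiableAt (by simp)).hasMFDerivAt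
  -- the seam push
  set σ : (BoundaryManifold.boundaryData 3 X).carrier → Base g :=
    fun y => (BoundaryManifold.boundaryData 3 (Base g)).incl (seamDiffeo bX (bBase g) Ψ y) with hσ
  have hσd : HasMFDerivAt (𝓡 3) (𝓡∂ 4) σ (c 0) (mfderiv (𝓡 3) (𝓡∂ 4) σ (c 0)) :=
    ((contMDiff_seamPush (seamDiffeo bX (bBase g) Ψ) (c 0)).mdifferentiableAt (by simp)).hasMFDerivAt
  have hR : HasMFDerivAt (𝓡∂ 4) (𝓡∂ 4) R₁ (σ (c 0)) (mfderiv (𝓡∂ 4) (𝓡∂ 4) R₁ (σ (c 0))) :=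
    hR₁.hasMFDerivAt
  have hval := hasMFDerivAt_incl_base (g := g) (R₁ (σ (c 0)))
  exact hval.comp 0 (hR.comp 0 (hσd.comp 0 hcd))

/-- **The transported dual framing read in `ℝ⁴` is `κ •` the fibre derivative of the belt-tube chart**
(brick G2-0): for `R₁ : Base g → Base g` differentiable at the dual circle point,
`ambient (dR₁ (q.attachingFraming θ)) = κ • ∂_m|₀ (R₁ (seam (β♭ (θ, m)))).1 (e₀)`.
[cite: MilnorHCobordism1965, §3] -/
theorem ambient_transport_dualFraming {R₁ : Base g → Base g} (j : ι)
    (θ : sphere (0 : EuclideanSpace ℝ (Fin 2)) 1)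
    (hR₁ : MDifferentiableAt (𝓡∂ 4) (𝓡∂ 4) R₁
      ((dualMap D bX (bBase g) Ψ col κ δ hκ hκ1 hδ hδ2 j).attachingCircle θ)) :
    ambient g (R₁ ((dualMap D bX (bBase g) Ψ col κ δ hκ hκ1 hδ hδ2 j).attachingCircle θ))
        (mfderiv (𝓡∂ 4) (𝓡∂ 4) R₁ ((dualMap D bX (bBase g) Ψ col κ δ hκ hκ1 hδ hδ2 j).attachingCircle θ)
          ((dualMap D bX (bBase g) Ψ col κ δ hκ hκ1 hδ hδ2 j).attachingFraming θ)) =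
      κ • fderiv ℝ (fun m : EuclideanSpace ℝ (Fin 2) =>
        (R₁ ((BoundaryManifold.boundaryData 3 (Base g)).incl (seamDiffeo bX (bBase g) Ψ
          ((beltMap D j).boundaryTube.toHomeo (θ, m))))).1) 0 planeE0 := by
  have hq : dualMap D bX (bBase g) Ψ col κ δ hκ hκ1 hδ hδ2 j =
      pushedMap (beltMap D j) (seamDiffeo bX (bBase g) Ψ) col κ δ hκ hκ1 hδ hδ2 := rfl
  have hcirc := dualCircle_eq_chart D bX Ψ col κ δ hκ hκ1 hδ hδ2 j θ
  have hR₁' : MDifferentiableAt (𝓡∂ 4) (𝓡∂ 4) R₁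
      ((BoundaryManifold.boundaryData 3 (Base g)).incl (seamDiffeo bX (bBase g) Ψ
        ((beltMap D j).boundaryTube.toHomeo (θ, (0 : EuclideanSpace ℝ (Fin 2)))))) := by
    rw [← hcirc]; exact hR₁
  rw [← mfderiv_eq_fderiv, (hasMFDerivAt_beltChart D bX Ψ j θ hR₁').mfderiv, hq, attachingFraming_pushedMap,
    tail_attachingFraming_eq_mfderiv_boundaryTube]
  have hcore : (⟨(beltMap D j).attachingCircle θ, (beltMap D j).isBoundaryPoint_attachingCircle θ⟩ :
      (BoundaryManifold.boundaryData 3 X).carrier) =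
      (beltMap D j).boundaryTube.toHomeo (θ, (0 : EuclideanSpace ℝ (Fin 2))) :=
    Subtype.ext ((beltMap D j).coe_boundaryTube_core θ).symm
  rw [hcore, ← hq, hcirc, ContinuousLinearMap.map_smul, ambient, ContinuousLinearMap.map_smul]
  rfl

/-- **Sub-goal `helper_dualFraming_chart` of stub `stub_T3_dualPresentation`** (T3 ▸ node `Hgap` ▸ part B
`helper_Hgap_twisting`, brick G2-0 plumbing; wave 6, lead c5): the transported dual framing read in
`ℝ⁴` is `κ •` the fibre derivative of the belt-tube chart `m ↦ (R₁ (seam (β♭ (θ, m)))).1` at `0`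
applied to `e₀`. [cite: MilnorHCobordism1965, §3] -/
theorem helper_dualFraming_chart : ∀ (g : ℕ) (ι : Type) [Finite ι] (h : ι → Literature.Topology.FourManifolds.HandleAttachingMap 3 2 (Literature.Topology.FourManifolds.LefschetzBase.Base g)) (X : Type) [TopologicalSpace X] [ChartedSpace (EuclideanHalfSpace 4) X] [IsManifold (𝓡∂ 4) ∞ X] (D : Literature.Topology.FourManifolds.HandleAttachingMap.MultiAttachmentData h (𝓡∂ 4) X) (bX : Literature.Topology.FourManifolds.BoundaryData (𝓡∂ 4) X (𝓡 3)) (Ψ : bX.carrier ≃ₘ⟮𝓡 3, 𝓡 3⟯ (Literature.Topology.FourManifolds.LefschetzBase.bBase g).carrier) (col : (Literature.Topology.FourManifolds.BoundaryManifold.boundaryData 3 (Literature.Topology.FourManifolds.LefschetzBase.Base g)).Collar) (κ δ : ℝ) (hκ : 0 < κ) (hκ1 : κ ≤ 1) (hδ : 0 < δ) (hδ2 : δ ≤ 1 / 2) (R₁ : Literature.Topology.FourManifolds.LefschetzBase.Base g → Literature.Topology.FourManifolds.LefschetzBase.Base g) (j : ι) (θ : Metric.sphere (0 : EuclideanSpace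 ℝ (Fin 2)) 1), MDifferentiableAt (𝓡∂ 4) (𝓡∂ 4) R₁ ((Summit.SmoothPoincare4.SmoothPoincare4.Theorems.AcyclicBisectionExists.ModpBraidOrbits.dualMap D bX (Literature.Topology.FourManifolds.LefschetzBase.bBase g) Ψ col κ δ hκ hκ1 hδ hδ2 j).attachingCircle θ) → Literature.Topology.FourManifolds.LefschetzBase.ambient g (R₁ ((Summit.SmoothPoincare4.SmoothPoincare4.Theorems.AcyclicBisectionExists.ModpBraidOrbits.dualMap D bX (Literature.Topology.FourManifolds.LefschetzBase.bBase g) Ψ col κ δ hκ hκ1 hδ hδ2 j).attachingCircle θ)) (mfderiv (𝓡∂ 4) (𝓡∂ 4) R₁ ((Summit.SmoothPoincare4.SmoothPoincare4.Theorems.AcyclicBisectionExists.ModpBraidOrbits.dualMap D bX (Literature.Topology.FourManifolds.LefschetzBase.bBase g) Ψ col κ δ hκ hκ1 hδ hδ2 j).attachingCircle θ) ((Summit.SmoothPoincare4.SmoothPoincare4.Theorems.AcyclicBisectionExists.ModpBraidOrbits.dualMap D bX (Literature.Topology.FourManifolds.LefschetzBase.bBase g) Ψ col κ δ hκ hκ1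 hδ hδ2 j).attachingFraming θ)) = κ • fderiv ℝ (fun m : EuclideanSpace ℝ (Fin 2) => (R₁ ((Literature.Topology.FourManifolds.BoundaryManifold.boundaryData 3 (Literature.Topology.FourManifolds.LefschetzBase.Base g)).incl (Summit.SmoothPoincare4.SmoothPoincare4.Theorems.AcyclicBisectionExists.ModpBraidOrbits.seamDiffeo bX (Literature.Topology.FourManifolds.LefschetzBase.bBase g) Ψ ((Summit.SmoothPoincare4.SmoothPoincare4.Theorems.AcyclicBisectionExists.ModpBraidOrbits.beltMap D j).boundaryTube.toHomeo (θ, m))))).1) 0 Literature.Topology.FourManifolds.planeE0 :=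
  fun _ _ _ _ _ _ _ _ D bX Ψ col κ δ hκ hκ1 hδ hδ2 _ j θ hR₁ =>
    ambient_transport_dualFraming D bX Ψ col κ δ hκ hκ1 hδ hδ2 j θ hR₁

/-- **The twisting loop of Hgap's framed knot in the chart**: for the transported dual attaching map
`q.transport (R.toDiffeomorph 1)` the twisting loop at `t` is
`(⟪κ Λ e₀, i K'⟫, ⟪κ Λ e₀, n⟫)`, `Λ = ∂_m|₀ (R₁ (seam (β♭ (e^{2πit}, m)))).1`. [cite: EtnyreFuller2006, §2] -/
theorem pageTwistingLoop_transport_dualMap (R : AmbientIsotopy (𝓡∂ 4) (Base g)) (j : ι) (t : ℝ) :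
    pageTwistingLoop g
        ((dualMap D bX (bBase g) Ψ col κ δ hκ hκ1 hδ hδ2 j).transport (R.toDiffeomorph 1)).attachingCircle
        ((dualMap D bX (bBase g) Ψ col κ δ hκ hκ1 hδ hδ2 j).transport (R.toDiffeomorph 1)).attachingFraming t =
      ⟨inner ℝ (κ • fderiv ℝ (fun m : EuclideanSpace ℝ (Fin 2) =>
          (R.toFun 1 ((BoundaryManifold.boundaryData 3 (Base g)).incl (seamDiffeo bX (bBase g) Ψ
            ((beltMap D j).boundaryTube.toHomeo (circlePt t, m))))).1) 0 planeE0)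
          (cplxJ (deriv (ambCurve g ((dualMap D bX (bBase g) Ψ col κ δ hκ hκ1 hδ hδ2 j).transport
            (R.toDiffeomorph 1)).attachingCircle) t)),
        inner ℝ (κ • fderiv ℝ (fun m : EuclideanSpace ℝ (Fin 2) =>
          (R.toFun 1 ((BoundaryManifold.boundaryData 3 (Base g)).incl (seamDiffeo bX (bBase g) Ψ
            ((beltMap D j).boundaryTube.toHomeo (circlePt t, m))))).1) 0 planeE0)
          (horizNormal g (ambCurve g ((dualMap D bX (bBase g) Ψ col κ δ hκ hκ1 hδ hδ2 j).transport
            (R.toDiffeomorph 1)).attachingCircle t))⟩ := by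
  have hR₁ : MDifferentiableAt (𝓡∂ 4) (𝓡∂ 4) (R.toFun 1)
      ((dualMap D bX (bBase g) Ψ col κ δ hκ hκ1 hδ hδ2 j).attachingCircle (circlePt t)) :=
    (R.toDiffeomorph 1).contMDiff.mdifferentiableAt (by simp)
  have key := ambient_transport_dualFraming D bX Ψ col κ δ hκ hκ1 hδ hδ2 j (circlePt t) hR₁
  rw [pageTwistingLoop, HandleAttachingMap.attachingFraming_transport]
  show (⟨inner ℝ (ambient g (R.toFun 1 ((dualMap D bX (bBase g) Ψ col κ δ hκ hκ1 hδ hδ2 j).attachingCircle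
      (circlePt t))) (mfderiv (𝓡∂ 4) (𝓡∂ 4) (R.toFun 1) _ _)) _, inner ℝ (ambient g (R.toFun 1
      ((dualMap D bX (bBase g) Ψ col κ δ hκ hκ1 hδ hδ2 j).attachingCircle (circlePt t)))
        (mfderiv (𝓡∂ 4) (𝓡∂ 4) (R.toFun 1) _ _)) _⟩ : ℂ) = _
  rw [key]

end Summit.SmoothPoincare4.SmoothPoincare4.Theorems.AcyclicBisectionExists.ModpBraidOrbits

end
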